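import Summits.ResolutionOfSingularities.ResolutionOfSingularities.Theorems.RadicialJungCleanModelsSuffice
import Literature.AlgebraicGeometry.Resolution.LogRegularResolutionGeneralHolds
import HarnessLib

/-!
# Item `CleanResolves` (stmt-ResolutionOfSingularities-16286, route `RadicialJung`, support) — PROVED

`RadicialJung.CleanResolves`: for `W` regular integral separated of finite type over a field of characteristic
`p`, `L/K(W)` purely inseparable of degree `p`, and a proper birational regular model `π : V → W` on which the
class of `L` is POINTWISE LOG-CLEAN (toroidal type `g = ∏ t_i^{a_i}`, `p ∤ a_i`, or regular type `g = u₀` a unit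
with `ū₀ ∉ κ^p` or `u₀ - c^p ∈ 𝔪 ∖ 𝔪²`), the normalisation of `W` in `L` has a resolution.

Proof (all ingredients in the tree): `CleanResolves.cleanResolves_of_self` reduces to the case `π = 𝟙`; there the
exceptionalisation game of `Theorems.RadicialJung.CleanModelsSuffice` reaches an end state on a proper birational
regular model (`endState_exists`), whose normalised cover carries a log-regular `LogAtlas`; Kato 1994 (10.4)
(`stub_gameEndResolves`, hypothesis `Kato1994_logRegularScheme_hasResolution`) resolves it.  The Kato hypothesis
is discharged by the theorem `Kato1994_logRegularScheme_hasResolution_holds` (2026-08-27).  This is verbatim the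
block `hSelf`/`hCR` inside `CleanModelsSuffice_of_kato`, now unconditional and exported BY NAME.
-/

noncomputable section

set_option linter.dupNamespace false -- mandated namespace of this single-conjunct summit

open CategoryTheory AlgebraicGeometry
open Literature.AlgebraicGeometry.Resolution

namespace Summit.ResolutionOfSingularities.ResolutionOfSingularities.Theorems

/-- **The `π = 𝟙` case of `CleanResolves`, unconditionally**: a regular integral separated finite-type `V/k`
(char `p`) carrying a POINTWISE LOG-CLEAN purely inseparable degree-`p` class `L/K(V)` has resolvable
normalisation `V^L` — end state of the exceptionalisation game (`endState_exists`) + Kato 1994 (10.4)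
(`stub_gameEndResolves` fed with `Kato1994_logRegularScheme_hasResolution_holds`). [folklore] -/
theorem hasResolution_normalizationIn_of_pointwiseLogClean (p : ℕ) (hp : p.Prime) (k : Type) [Field k]
    [CharP k p] (V : Scheme.{0}) [IsIntegral V] (f : V ⟶ Spec (.of k)) (L : Type) [Field L]
    [Algebra V.functionField L] (hsep : IsSeparated f) (hloc : LocallyOfFiniteType f)
    (hqc : QuasiCompact f) (hVreg : Scheme.IsRegular V) (hPI : IsPurelyInseparable V.functionField L)
    (hdeg : Module.finrank V.functionField L = p)
    (hclean : ∀ v : V, ∃ (y : L) (g : V.functionField),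
      y ∉ Set.range (algebraMap V.functionField L) ∧ algebraMap V.functionField L g = y ^ p ∧
      ((∃ (d m : ℕ) (hmd : m ≤ d) (t : Fin d → V.presheaf.stalk v) (a : Fin m → ℕ),
          Ideal.span (Set.range t) = IsLocalRing.maximalIdeal (V.presheaf.stalk v) ∧
          ringKrullDim (V.presheaf.stalk v) = (d : WithBot ℕ∞) ∧ 0 < m ∧ (∀ i, ¬ p ∣ a i) ∧
          g = ∏ i : Fin m,
            (algebraMap (V.presheaf.stalk v) V.functionField (t (Fin.castLE hmd i))) ^ (a i)) ∨
        (∃ u₀ : V.presheaf.stalk v, IsUnit u₀ ∧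
          g = algebraMap (V.presheaf.stalk v) V.functionField u₀ ∧
          ((∀ c : V.presheaf.stalk v,
              u₀ - c ^ p ∉ IsLocalRing.maximalIdeal (V.presheaf.stalk v)) ∨
            (∃ c : V.presheaf.stalk v,
              u₀ - c ^ p ∈ IsLocalRing.maximalIdeal (V.presheaf.stalk v) ∧
              u₀ - c ^ p ∉ IsLocalRing.maximalIdeal (V.presheaf.stalk v) ^ 2))))) :
    Scheme.HasResolution (normalizationIn V L) := by
  haveI := hsep; haveI := hloc; haveI := hqc; haveI := hPI
  obtain ⟨V', hV'int, π', hdom, hprop, hbir, S, hend⟩ :=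
    RadicialJung.CleanModelsSuffice.endState_exists p hp k V f L hVreg hdeg hclean
  haveI := hV'int; haveI := hdom; haveI := hprop
  exact RadicialJung.CleanModelsSuffice.stub_gameEndResolves
    Kato1994_logRegularScheme_hasResolution_holds.{0} p hp k V f L hdeg V' π' hbir S hend

/-- **Item stmt-ResolutionOfSingularities-16286 `RadicialJung.CleanResolves`, proved**: a pointwise
log-clean proper birational regular model `π : V → W` of a degree-`p` purely inseparable class `L/K(W)`
resolves the normalisation of `W` in `L` — `CleanResolves.cleanResolves_of_self` applied to the unconditional
`π = 𝟙` case above. [folklore] -/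
theorem cleanResolves_proof :
    Summit.ResolutionOfSingularities.ResolutionOfSingularities.Theses.RadicialJung.CleanResolves :=
  RadicialJung.CleanResolves.cleanResolves_of_self hasResolution_normalizationIn_of_pointwiseLogClean

end Summit.ResolutionOfSingularities.ResolutionOfSingularities.Theorems

end
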